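import Summits.AtomisticToContinuum.HydrodynamicLimit.Theorems.CollisionIsometryCLTMacroClosureBarycentricDefs
import Mathlib.Analysis.SpecialFunctions.Gaussian.FourierTransform
import HarnessLib

/-!
# Stub `stub_blockMGF` of the line `IdeatorTwoGen1Sketch` (crux `MacroClosure`, stmt-14870), part 1:
# the one-particle Gaussian Laplace transform (registered sub-goal `stub_blockMGF_gauss`)

Proof file (`--supports stmt-AtomisticToContinuum-14870`) for the first registered sub-goal of the
stub `Barycentric.stub_blockMGF : HomogeneousBlockMGF` (the homogeneous sub-unit block MGF on the
band). Under the homogeneous canonical law `localGibbsLaw σ 1 u_c θ_c` the velocities are, given the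
positions, i.i.d. `gaussMeasure u_c θ_c = N(u_c, θ_c id)` (`localGibbsMeasure_rung0_eq_map`); every
velocity statistic of a block (drift `ū`, temperature `θ̄`) is therefore integrated particle by
particle against the isotropic Gaussian, and the only transcendental input is the quadratic
exponential moment computed here exactly:

`∫ exp(−α‖v − c‖²) N(u, θ id)(dv) = (1 + 2αθ)^{−3/2} exp(−α‖u − c‖²/(1 + 2αθ))`, `2αθ > −1`

(`integral_exp_neg_mul_norm_sub_sq_gaussMeasure`; completing the square + Mathlib's
`GaussianFourier.integral_rexp_neg_mul_sq_norm`). For `α ≥ 0` (cold tilt) the right side is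
`≤ (1 + 2αθ)^{−3/2}` whatever the centre `c` — this is the one-step bound of the weighted Helmert
recursion of part 2 (`stub_blockMGF_kinetic`), in `lintegral` form
(`lintegral_exp_neg_mul_norm_sub_sq_gaussMeasure_le`); for `−1 < 2αθ < 0` (hot tilt) it is the exact
single-particle exponential moment of the kinetic energy about `c`.
-/

noncomputable section

open MeasureTheory Filter Set Topology InformationTheory ProbabilityTheory
open scoped ENNReal ContDiff InnerProductSpace

namespace Summit.AtomisticToContinuum.HydrodynamicLimit.Theorems.MacroClosureLine

open Literature.MathematicalPhysics.KineticTheory Literature.Analysis.FluidPDE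
open Literature.Analysis.FunctionSpaces

namespace Barycentric

/-- **Completing the square**: `‖w‖²/2 + a‖w − d‖² = (1/2 + a)‖w − (2a/(1+2a)) d‖² + a‖d‖²/(1 + 2a)`
for `1 + 2a ≠ 0`. [folklore] -/
theorem half_norm_sq_add_mul_norm_sub_sq {a : ℝ} (ha : 1 + 2 * a ≠ 0) (w d : V3) :
    ‖w‖ ^ 2 / 2 + a * ‖w - d‖ ^ 2 =
      (1 / 2 + a) * ‖w - (2 * a / (1 + 2 * a)) • d‖ ^ 2 + a * ‖d‖ ^ 2 / (1 + 2 * a) := by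
  rw [norm_sub_sq_real, norm_sub_sq_real, inner_smul_right, norm_smul, mul_pow, Real.norm_eq_abs,
    sq_abs]
  field_simp
  ring

/-- The global Maxwellian of `ℝ³`: `M(w) = (2π)^{-3/2} exp(−‖w‖²/2)`. [folklore] -/
theorem globalMaxwellian_V3 (w : V3) :
    globalMaxwellian w = (2 * Real.pi) ^ (-(3 : ℝ) / 2) * Real.exp (-‖w‖ ^ 2 / 2) := by
  simp [globalMaxwellian]

/-- The Gaussian normalisation algebra `(2π)^{-3/2} (π/b)^{3/2} = (2b)^{-3/2}` (`b > 0`). [folklore] -/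
theorem gauss_const_mul {b : ℝ} (hb : 0 < b) :
    (2 * Real.pi) ^ (-(3 : ℝ) / 2) * (Real.pi / b) ^ ((3 : ℝ) / 2) = (2 * b) ^ (-(3 : ℝ) / 2) := by
  have hπ : 0 < Real.pi := Real.pi_pos
  rw [show (-(3 : ℝ) / 2) = -((3 : ℝ) / 2) by ring, Real.rpow_neg (by positivity),
    Real.rpow_neg (by positivity), Real.div_rpow hπ.le hb.le, Real.mul_rpow (by norm_num) hπ.le,
    Real.mul_rpow (by norm_num) hb.le]
  have h2 : 0 < (2 : ℝ) ^ ((3 : ℝ) / 2) := Real.rpow_pos_of_pos (by norm_num) _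
  have h3 : 0 < Real.pi ^ ((3 : ℝ) / 2) := Real.rpow_pos_of_pos hπ _
  have h4 : 0 < b ^ ((3 : ℝ) / 2) := Real.rpow_pos_of_pos hb _
  field_simp

/-- **One-particle Gaussian Laplace transform** (exact): for `θ > 0` and `2αθ > −1`,
`∫ exp(−α‖v − c‖²) N(u, θ id)(dv) = (1 + 2αθ)^{−3/2} exp(−α‖u − c‖²/(1 + 2αθ))`. [folklore] -/
theorem integral_exp_neg_mul_norm_sub_sq_gaussMeasure (u c : V3) {θ α : ℝ} (hθ : 0 < θ)
    (hα : -1 < 2 * α * θ) :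
    ∫ v, Real.exp (-α * ‖v - c‖ ^ 2) ∂(gaussMeasure u θ) =
      (1 + 2 * α * θ) ^ (-(3 : ℝ) / 2) * Real.exp (-(α * ‖u - c‖ ^ 2 / (1 + 2 * α * θ))) := by
  have hsq : 0 < Real.sqrt θ := Real.sqrt_pos.2 hθ
  set a : ℝ := α * θ with ha_def
  have ha : 0 < 1 + 2 * a := by rw [ha_def]; linarith
  have hb : 0 < 1 / 2 + a := by linarith
  set d : V3 := (Real.sqrt θ)⁻¹ • (c - u) with hd_def
  set q : V3 := (2 * a / (1 + 2 * a)) • d with hq_def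
  set κ : ℝ := a * ‖d‖ ^ 2 / (1 + 2 * a) with hκ_def
  -- the change of variables `v = u + √θ w`
  have hshift : ∀ w : V3, u + Real.sqrt θ • w - c = Real.sqrt θ • (w - d) := by
    intro w
    rw [hd_def, smul_sub, smul_smul, mul_inv_cancel₀ hsq.ne', one_smul]
    abel
  have step1 : ∫ v, Real.exp (-α * ‖v - c‖ ^ 2) ∂(gaussMeasure u θ) =
      ∫ w, globalMaxwellian w * Real.exp (-a * ‖w - d‖ ^ 2) := by
    rw [integral_gaussMeasure u hθ, integral_stdGaussian_eq_integral_mul_globalMaxwellian]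
    refine integral_congr_ae (ae_of_all _ fun w => ?_)
    dsimp only
    rw [hshift w, norm_smul, mul_pow, Real.norm_eq_abs, sq_abs, Real.sq_sqrt hθ.le, ha_def]
    congr 2
    ring
  -- completing the square under the integral
  have step2 : ∀ w : V3, globalMaxwellian w * Real.exp (-a * ‖w - d‖ ^ 2) =
      ((2 * Real.pi) ^ (-(3 : ℝ) / 2) * Real.exp (-κ)) * Real.exp (-(1 / 2 + a) * ‖w - q‖ ^ 2) := by
    intro w
    rw [globalMaxwellian_V3, mul_assoc, mul_assoc, ← Real.exp_add, ← Real.exp_add]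
    congr 2
    have h := half_norm_sq_add_mul_norm_sub_sq ha.ne' w d
    rw [hκ_def, hq_def]
    linarith
  have step3 : ∫ w : V3, Real.exp (-(1 / 2 + a) * ‖w - q‖ ^ 2) = (Real.pi / (1 / 2 + a)) ^ ((3 : ℝ) / 2) := by
    rw [integral_sub_right_eq_self (μ := (volume : Measure V3)) (fun w => Real.exp (-(1 / 2 + a) * ‖w‖ ^ 2)) q,
      GaussianFourier.integral_rexp_neg_mul_sq_norm hb]
    simp
  rw [step1, integral_congr_ae (ae_of_all _ step2), integral_const_mul, step3]
  -- constants
  have hκ : κ = α * ‖u - c‖ ^ 2 / (1 + 2 * α * θ) := by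
    rw [hκ_def, hd_def, norm_smul, mul_pow, Real.norm_eq_abs, sq_abs, inv_pow, Real.sq_sqrt hθ.le,
      norm_sub_rev, ha_def]
    field_simp
  rw [mul_right_comm, gauss_const_mul hb, hκ]
  congr 1
  · congr 1
    rw [ha_def]
    ring

/-- **Cold one-step bound** (`lintegral` form): for `θ > 0`, `α ≥ 0` and every centre `c`,
`∫⁻ exp(−α‖v − c‖²) N(u, θ id)(dv) ≤ (1 + 2αθ)^{−3/2}`. [folklore] -/
theorem lintegral_exp_neg_mul_norm_sub_sq_gaussMeasure_le (u c : V3) {θ α : ℝ} (hθ : 0 < θ)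
    (hα : 0 ≤ α) :
    ∫⁻ v, ENNReal.ofReal (Real.exp (-α * ‖v - c‖ ^ 2)) ∂(gaussMeasure u θ) ≤
      ENNReal.ofReal ((1 + 2 * α * θ) ^ (-(3 : ℝ) / 2)) := by
  have hmeas : AEStronglyMeasurable (fun v : V3 => Real.exp (-α * ‖v - c‖ ^ 2)) (gaussMeasure u θ) := by
    refine Continuous.aestronglyMeasurable ?_
    fun_prop
  have hint : Integrable (fun v : V3 => Real.exp (-α * ‖v - c‖ ^ 2)) (gaussMeasure u θ) := by
    refine Integrable.mono' (integrable_const (1 : ℝ)) hmeas (ae_of_all _ fun v => ?_)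
    rw [Real.norm_eq_abs, abs_of_pos (Real.exp_pos _), Real.exp_le_one_iff]
    nlinarith [sq_nonneg ‖v - c‖]
  rw [← ofReal_integral_eq_lintegral_ofReal hint (ae_of_all _ fun v => (Real.exp_pos _).le),
    integral_exp_neg_mul_norm_sub_sq_gaussMeasure u c hθ (by nlinarith)]
  refine ENNReal.ofReal_le_ofReal ?_
  have h1 : 0 < 1 + 2 * α * θ := by nlinarith
  refine mul_le_of_le_one_right (Real.rpow_nonneg h1.le _) ?_
  rw [Real.exp_le_one_iff, neg_nonpos]
  positivity

/-- **`stub_blockMGF_gauss`** (registered sub-goal of `stub_blockMGF`): the one-particle Gaussian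
Laplace transform of the kinetic energy about an arbitrary centre, under the velocity marginal
`gaussMeasure u θ = N(u, θ id)` of the homogeneous local Gibbs law — exact for `2αθ > −1` (hot and
cold tilts), which is the single transcendental input of the block velocity statistics (drift and
temperature) of `HomogeneousBlockMGF`. [folklore] -/
theorem stub_blockMGF_gauss : ∀ (u c : V3) (θ α : ℝ), 0 < θ → -1 < 2 * α * θ → ∫ v, Real.exp (-α * ‖v - c‖ ^ 2) ∂(gaussMeasure u θ) = (1 + 2 * α * θ) ^ (-(3 : ℝ) / 2) * Real.exp (-(α * ‖u - c‖ ^ 2 / (1 + 2 * α * θ))) :=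
  fun u c _ _ hθ hα => integral_exp_neg_mul_norm_sub_sq_gaussMeasure u c hθ hα

end Barycentric

end Summit.AtomisticToContinuum.HydrodynamicLimit.Theorems.MacroClosureLine

end
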